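import Literature.NumberTheory.Transcendental.BoxIntegralHurwitzWeightTwo
import Literature.Analysis.SpecialFunctions.TanhPartialFractions
import Literature.NumberTheory.Transcendental.KZCalculus

/-!
# `NormalFormPrinciple` (stmt-KontsevichZagierPeriods-3869), line `SketchIdeator1` —
# the leaf `stub_boxRigidity` in dimension two, level two: the value of `[(0,1)², β/(1 − x²y²)]`

Pure proof file (stub `value_levelTwoRep` of the dimension-two, level-two layer, lead seat c7;
`--supports` the crux). The box part of the level-two normal form
`β[(0,1)², 1/(1 − x₀²x₁²)] + γ[(1,2), 1/y] + [pt, q]` represents `β · π²/8`: for an integral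
representation `B` of dimension `2` (`Literature.NumberTheory.Transcendental.KZ.IntegralRep 2`)
whose domain is the open unit box and whose integrand agrees with `x ↦ β/(1 − (x₀x₁)²)` there,

  `B.value = ∫∫_{(0,1)²} β dx₀dx₁/(1 − (x₀x₁)²) = β · Σ_{k≥0} 1/(2k+1)² = β · π²/8`

(the even sub-series of Beukers' double integral: expand `1/(1 − t²) = Σ_k t^{2k}`, `t = x₀x₁`,
integrate term-wise `∫∫ (x₀x₁)^{2k} = 1/(2k+1)²` — the tree's weight-`2` Hurwitz box integral
`BoxIntegral.setIntegral_box_pow_div_one_sub_pow` at level `m = 2`, `r = 0` — and sum Euler's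
odd-square series `Σ 1/(2k+1)² = π²/8`, the tree's
`Literature.Analysis.SpecialFunctions.hasSum_one_div_odd_sq`; the constant `β` is pulled out of
the set integral).

Sources: M. Kontsevich, D. Zagier, *Periods* (2001), §1.1; F. Beukers, *A note on the
irrationality of ζ(2) and ζ(3)*, Bull. LMS 11 (1979). No definitions are introduced.
-/

noncomputable section

open MeasureTheory Set
open Literature.NumberTheory.Transcendental Literature.NumberTheory.Transcendental.KZ

namespace Summit.KontsevichZagierPeriods.HurwitzMicroSectors.NormalFormPrinciple.PiBox.LevelN

/-- **The level-two box integral**: `∫∫_{(0,1)²} dx₀dx₁/(1 − (x₀x₁)²) = Σ_{k≥0} 1/(2k+1)² = π²/8`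
(the weight-`2` Hurwitz box integral at level `2`, `r = 0`, summed by Euler's odd-square series).
[folklore] -/
theorem setIntegral_box_one_div_one_sub_mul_sq :
    ∫ x in {x : Fin 2 → ℝ | ∀ i, x i ∈ Set.Ioo (0:ℝ) 1}, 1 / (1 - (x 0 * x 1) ^ 2)
      = Real.pi ^ 2 / 8 := by
  have h := BoxIntegral.setIntegral_box_pow_div_one_sub_pow (m := 2) (by norm_num) 0
  simp only [pow_zero, Nat.cast_zero, add_zero, Nat.cast_ofNat] at h
  rw [h, ← Literature.Analysis.SpecialFunctions.hasSum_one_div_odd_sq.tsum_eq]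

/-- **V5 (value of the level-two box part).** An integral representation of dimension `2` on the
open unit box `(0,1)²` with integrand `β/(1 − (x₀x₁)²)` (`β ∈ ℚ`) represents `β · π²/8`
(`∫∫_{(0,1)²} dx₀dx₁/(1 − (x₀x₁)²) = Σ_{k≥0} 1/(2k+1)² = π²/8`).
[cite: KontsevichZagier2001, §1.1] -/
theorem value_levelTwoRep (β : ℚ) (B : IntegralRep 2)
    (hBd : B.domain = {x | ∀ i, x i ∈ Set.Ioo (0:ℝ) 1})
    (hBi : EqOn B.integrand (fun x => (β : ℝ) / (1 - (x 0 * x 1) ^ 2)) B.domain) :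
    B.value = (β : ℝ) * (Real.pi ^ 2 / 8) := by
  rw [KZ.IntegralRep.value, setIntegral_congr_fun (KZ.IntegralRep.measurableSet_domain_holds B) hBi,
    hBd]
  simp_rw [div_eq_mul_one_div (β : ℝ)]
  rw [integral_const_mul, setIntegral_box_one_div_one_sub_mul_sq]

end Summit.KontsevichZagierPeriods.HurwitzMicroSectors.NormalFormPrinciple.PiBox.LevelN
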